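import Summits.ResolutionOfSingularities.ResolutionOfSingularities.Theorems.FrobeniusClosingSteerK7HatWords
import Literature.AlgebraicGeometry.Resolution.CompletionBaseChange
import Mathlib.RingTheory.AdicCompletion.Noetherian
import HarnessLib

/-!
# Crux `Steer` (stmt-ResolutionOfSingularities-16345), chain W4.1 — K-β7-hat support word F0 `HatFrame` PROVED

OURS (campaign `res-hironaka`, rung L ★L-G4, slot W4.1). F0 `HatFrame` is the first support word of res-L0-w41-idea-1 g12's K-β7-HAT SIGNATURES
(`K7HatWords-idea-1-g12.lean` cbdb8a4f311bfcb9, tree words file `…Theorems.FrobeniusClosingSteerK7HatWords`; res-L0-w41-plan-1 RULINGS 237(b) /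
241(c) / 242(c): «F0/S0 → res-D-pv-035»): an `IsHatOf`-presentation `ι : S →+* T` of a local ring `S` (T Noetherian, `𝔪_T`-adically complete,
`𝔪_S T = 𝔪_T`, `ι(S)` dense, `𝔪_Tⁿ ∩ S = 𝔪_Sⁿ`) is ISOMORPHIC OVER `S` to Mathlib's `AdicCompletion (maximalIdeal S) S` — the frame `e` that every
crux piece W1–W3 receives, produced ONCE by the assembly `formalCentreDescent_of`. Replaces the role of no printed item; NOT a statement of the manuscript
under review [claim: Hironaka2017, status: under-review]; AI-produced, weaker than expert review; counted 0.

KERNEL PROOF (`hatFrame_core`). The level maps `S ⧸ 𝔪_Sⁿ → T ⧸ 𝔪_Tⁿ` are injective (contraction clause) and surjective (density clause), so the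
tree's criterion `Literature.AlgebraicGeometry.Resolution.adicCompletionEquivOfQuotientMap` (`CompletionBaseChange.lean`: a ring map with bijective
level maps induces `S^_{𝔪_S} ≃+* T^_{𝔪_T}`, extending `ι` on the images — `adicCompletionEquivOfQuotientMap_of`) gives `E : Ŝ ≃+* T̂`; `T` is
`𝔪_T`-adically complete, so Mathlib's `AdicCompletion.ofAlgEquiv (maximalIdeal T) : T ≃ₐ[T] T̂`; the frame is `e := ofAlgEquiv ≫ E⁻¹`, and
`e (ι a) = E⁻¹ (of (ι a)) = of a = algebraMap S Ŝ a`. The Noetherian clause of `IsHatOf` is not used.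
[cite: Matsumura1987, Thm. 8.7, Thm. 8.11] [folklore]
bears_on: LADDER-RESOLUTION L ★L-G4 W4.1 (crux `Steer`, β-leaf binder hβ6′ `FormalCentreDescent`, support word F0).
-/

noncomputable section

set_option linter.dupNamespace false
set_option autoImplicit false

open IsLocalRing

namespace Summit.ResolutionOfSingularities.ResolutionOfSingularities.Theorems.SwitchingDichotomy.K7HatFrame

open Literature.AlgebraicGeometry.Resolution
open Summit.ResolutionOfSingularities.ResolutionOfSingularities.Theorems.SwitchingDichotomy.K7Hat


/-! ## The frame -/

section Core

variable {S T : Type} [CommRing S] [IsLocalRing S] [CommRing T] [IsLocalRing T]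

/-- **F0, core form.** For `ι : S →+* T` with `T` `𝔪_T`-adically complete, `𝔪_S T = 𝔪_T`, `ι(S)` dense and `𝔪_Tⁿ ∩ S = 𝔪_Sⁿ`, there is a ring
isomorphism `e : T ≃+* AdicCompletion (maximalIdeal S) S` with `e ∘ ι = algebraMap`: the level maps `S ⧸ 𝔪_Sⁿ → T ⧸ 𝔪_Tⁿ` are bijective, so
`Ŝ ≃+* T̂` (`adicCompletionEquivOfQuotientMap`), and `T ≃ T̂` (`AdicCompletion.ofAlgEquiv`). [cite: Matsumura1987, Thm. 8.7] -/
theorem hatFrame_core (ι : S →+* T) (hcomplete : IsAdicComplete (maximalIdeal T) T)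
    (hmax : (maximalIdeal S).map ι = maximalIdeal T)
    (hdense : ∀ (n : ℕ) (t : T), ∃ a : S, t - ι a ∈ maximalIdeal T ^ n)
    (hcontr : ∀ (n : ℕ) (a : S), ι a ∈ maximalIdeal T ^ n → a ∈ maximalIdeal S ^ n) :
    ∃ e : T ≃+* AdicCompletion (maximalIdeal S) S,
      ∀ a : S, e (ι a) = algebraMap S (AdicCompletion (maximalIdeal S) S) a := by
  haveI := hcomplete
  have h : (maximalIdeal S).map ι ≤ maximalIdeal T := hmax.le
  have hb : ∀ n, Function.Bijective
      (Ideal.quotientMap (maximalIdeal T ^ n) ι (pow_le_comap_pow_of_map_le ι h n)) := by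
    intro n
    constructor
    · rw [injective_iff_map_eq_zero]
      intro z hz
      obtain ⟨a, rfl⟩ := Ideal.Quotient.mk_surjective z
      rw [Ideal.quotientMap_mk] at hz
      exact Ideal.Quotient.eq_zero_iff_mem.mpr (hcontr n a (Ideal.Quotient.eq_zero_iff_mem.mp hz))
    · intro z
      obtain ⟨t, rfl⟩ := Ideal.Quotient.mk_surjective z
      obtain ⟨a, ha⟩ := hdense n t
      refine ⟨Ideal.Quotient.mk _ a, ?_⟩
      rw [Ideal.quotientMap_mk]
      exact ((Ideal.Quotient.mk_eq_mk_iff_sub_mem _ _).mpr ha).symm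
  let E : AdicCompletion (maximalIdeal S) S ≃+* AdicCompletion (maximalIdeal T) T :=
    adicCompletionEquivOfQuotientMap (maximalIdeal S) (maximalIdeal T) ι h hb
  let F : T ≃+* AdicCompletion (maximalIdeal T) T := (AdicCompletion.ofAlgEquiv (maximalIdeal T)).toRingEquiv
  refine ⟨F.trans E.symm, fun a => ?_⟩
  rw [RingEquiv.trans_apply, RingEquiv.symm_apply_eq]
  change AdicCompletion.ofAlgEquiv (maximalIdeal T) (ι a) =
    adicCompletionEquivOfQuotientMap (maximalIdeal S) (maximalIdeal T) ι h hb (AdicCompletion.of (maximalIdeal S) S a)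
  rw [AdicCompletion.ofAlgEquiv_apply, adicCompletionEquivOfQuotientMap_of]

end Core

/-- **F0 `HatFrame` HOLDS** (support word of the K-β7-hat programme, idea-1 cbdb8a4f311bfcb9): `hatFrame_core` with the completeness, `𝔪_S T = 𝔪_T`,
density and contraction clauses of `IsHatOf`. OURS. [cite: Matsumura1987, Thm. 8.7] -/
theorem hatFrame_holds : HatFrame := by
  intro S T _ _ _ _ ι hhat
  exact hatFrame_core ι hhat.2.1 hhat.2.2.1 hhat.2.2.2.1 hhat.2.2.2.2

end Summit.ResolutionOfSingularities.ResolutionOfSingularities.Theorems.SwitchingDichotomy.K7HatFrame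

end
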